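import Summits.AnomalousDissipation.AnomalousDissipation.Theorems.BaireTransferDenseLoudDesignerForcesErgodicPeriodicOrbitA
import Summits.AnomalousDissipation.AnomalousDissipation.Theorems.DenseLoudDesignerForces.Negative.PowerBudget
import Summits.AnomalousDissipation.AnomalousDissipation.Theorems.DenseLoudDesignerForces.Negative.WindowBounds
import Literature.Analysis.FluidPDE.StokesTorusSemigroup
import HarnessLib

/-!
# The objects of the smooth-model assembly (block N, line ergodic-budget-selection-closing of the crux `DenseLoudDesignerForces`)

Theorems-side DEFINITIONS (no proofs) for the assembly of the registered stub `stub_smoothModel` of the crux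
`Summit.AnomalousDissipation.AnomalousDissipation.Theses.BaireTransfer.DenseLoudDesignerForces` (N-programme §§6–7 in the crux directory):

* `ModelFrame` — the frame data of the MILD formulation of NS_ν on `Hsp`: the Stokes MODE basis `b` with eigenvalues `m`
  (`exists_hilbertBasis_stokes_holds`), the diagonal frame operators `S = (1+A)^{-1/2}`, `T t = e^{-tA}`, `K t = A^{3/4}e^{-tA}`
  pinned by their actions on the basis with their laws (landed: `stub_stokesSemigroupFrameTools`, `exists_semigroupFrame_of_eq_diagonalPMap`),
  and the bounded bilinear form `Nb = A^{-3/4}S⁻¹PB(S·,S·)` through its coefficient formula (registered stub `stub_mildBilinearFormTools`);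
  the existence of a `ModelFrame` is a theorem assembled from those stubs, not assumed here;
* `ModelFrame.IsMild` — continuous mild solutions `z(r) = T(νr)y + ∫₀ʳT(ν(r−s))x_f ds − ∫₀ʳ K(ν(r−s)) Nb(z,z) ds` on `[0, t]`
  (the equation of the landed abstract flow theorems `exists_smoothMildFlow` / `exists_mildTube`);
* `ModelFrame.modelMap` — THE MODEL MAP `g`: for `t ≥ 0`, `g t y` is the value at `t` of a continuous mild solution on `[0,t]` from `y`
  whose range stays in the prescribed set `U'`, when one exists (unique by the singular Grönwall lemma), junk `0` otherwise; `g t = g 0`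
  for `t < 0`.  With this definition the local semigroup law of `IsHyperbolicSemiflowModel.map_add` holds EXACTLY (both sides are the
  concatenated solution when it stays in `U'`, and both are the junk `0` otherwise) — no maximal-solution theory is needed.

## References

* D. Henry, *Geometric Theory of Semilinear Parabolic Equations*, LNM 840 (1981), §3.3 (mild solutions). [Henry1981]
* P. Constantin, C. Foias, *Navier–Stokes Equations* (1988), Ch. 4–6 (Stokes operator, the form `B`). [ConstantinFoiasNSE1988]
-/

set_option linter.dupNamespace false

noncomputable section

open Set Function MeasureTheory Filter
open scoped InnerProductSpace RealInnerProductSpace Topology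

namespace Summit.AnomalousDissipation.AnomalousDissipation.Theorems.DenseLoudDesignerForces.Ergodic

open Literature.Analysis.FunctionSpaces Literature.Analysis.FunctionSpaces.Torus
open Literature.Analysis.FluidPDE Literature.Analysis.FluidPDE.Torus
open Summit.AnomalousDissipation.AnomalousDissipation.Theses.BaireTransfer
open Summit.AnomalousDissipation.AnomalousDissipation.Theorems.DenseLoudDesignerForces.Negative

/-- **The designer force is smooth, divergence-free and mean-zero** (registered tools stub F0 `stub_designerForceTools`): `force S c` is the real
trigonometric polynomial with Leray-projected coefficients, so it is smooth (`Negative.isSmooth_force`), divergence-free (`Negative.isDivFree_force`)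
and its zero Fourier mode vanishes (`lerayCoeff 0 _ = 0`), whence zero mean. [folklore] -/
theorem stub_designerForceTools (S : Finset (Fin 3 → ℤ)) (c : ↥S → (EuclideanSpace ℂ (Fin 3))) :
    IsSmooth (force S c) ∧ IsDivFree (force S c) ∧ HasZeroMean (force S c) := by
  refine ⟨Negative.isSmooth_force S c, Negative.isDivFree_force S c, ?_⟩
  set g : (Fin 3 → ℤ) → EuclideanSpace ℂ (Fin 3) := fun k => Torus.lerayCoeff k (coeffExt S c k) with hg
  show ∫ x, EuclideanSpace.realPart (trigPoly S g x) = 0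
  rw [EuclideanSpace.realPart.integral_comp_comm (continuous_trigPoly S g).integrable_unitAddTorus]
  have h : ∫ x, trigPoly S g x = 0 := by
    simp_rw [trigPoly_apply]
    rw [integral_finsetSum S (f := fun k x => UnitAddTorus.mFourier k x • g k) fun k _ =>
      ((UnitAddTorus.mFourier k).continuous.smul continuous_const).integrable_unitAddTorus]
    refine Finset.sum_eq_zero fun k _ => ?_
    rw [integral_smul_const, integral_mFourier]
    by_cases hk : k = 0
    · subst hk; simp [hg]
    · simp [hk]
  rw [h, map_zero]

/-- **The frame of the mild formulation**: the Stokes mode basis of `Hsp` with its eigenvalues, the diagonal operators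
`S = (1+A)^{-1/2}`, `T t = e^{-tA}`, `K t = A^{3/4}e^{-tA}` pinned by their actions on the basis, and a bounded bilinear form `Nb` with the
coefficient formula of S3 (Constantin–Foias 1988 Ch. 4 (4.11)–(4.13), Ch. 6 (6.9)–(6.10); Henry 1981 §1.4). [cite: ConstantinFoiasNSE1988, Ch. 4 (4.11)–(4.13) and Ch. 6 (6.9)–(6.10)] -/
@[folklore] structure ModelFrame where
  /-- index type of the mode basis -/
  ι : Type
  /-- the Stokes mode basis -/
  b : HilbertBasis ι ℝ Hsp
  /-- the eigenvalues -/
  m : ι → ℝ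
  /-- the frame operator `(1+A)^{-1/2}` -/
  S : Hsp →L[ℝ] Hsp
  /-- the Stokes semigroup -/
  T : ℝ → Hsp →L[ℝ] Hsp
  /-- the smoothing family `A^{3/4} e^{-tA}` -/
  K : ℝ → Hsp →L[ℝ] Hsp
  /-- the bilinear form `A^{-3/4} S⁻¹ P B(S·, S·)` -/
  Nb : Hsp →L[ℝ] Hsp →L[ℝ] Hsp
  /-- positivity of the eigenvalues -/
  hpos : ∀ i, 0 < m i
  /-- the eigenvalues diverge -/
  htend : Tendsto m cofinite atTop
  /-- the Stokes operator is diagonal in the basis -/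
  hA : stokesOperatorH (Fin 3) = b.diagonalPMap m
  /-- every basis vector is a Stokes Fourier mode -/
  hmodes : ∀ i, ∃ (k : Fin 3 → ℤ) (a : EuclideanSpace ℝ (Fin 3)) (c : Bool), k ≠ 0 ∧ a ≠ 0 ∧ ⟪latticeVec k, a⟫_ℝ = 0 ∧
    ((b i : Hsp) : Lp (EuclideanSpace ℝ (Fin 3)) 2 (volume : Measure (UnitAddTorus (Fin 3)))) = stokesModeL2 k a c ∧
    m i = stokesEigenvalue k
  /-- `S` on the basis -/
  hS : ∀ i, S (b i) = ((1 + m i) ^ (-(1 / 2 : ℝ))) • b i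
  /-- `S` is injective -/
  hSinj : Function.Injective S
  /-- `T` on the basis -/
  hT : ∀ t i, 0 ≤ t → T t (b i) = Real.exp (-(t * m i)) • b i
  /-- contraction -/
  hTnorm : ∀ t, 0 ≤ t → ‖T t‖ ≤ 1
  /-- `T 0 = 1` -/
  hT0 : T 0 = 1
  /-- semigroup law -/
  hTadd : ∀ s t, 0 ≤ s → 0 ≤ t → T (s + t) = (T s).comp (T t)
  /-- strong continuity -/
  hTc : ∀ y : Hsp, Continuous fun t : ℝ => T t y
  /-- `T` commutes with `S` -/
  hTS : ∀ t, (T t).comp S = S.comp (T t)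
  /-- self-adjointness -/
  hTsa : ∀ t, 0 ≤ t → IsSelfAdjoint (T t)
  /-- `K` on the basis -/
  hK : ∀ t i, 0 < t → K t (b i) = ((m i) ^ (3 / 4 : ℝ) * Real.exp (-(t * m i))) • b i
  /-- the smoothing bound `‖K t‖ ≤ t^{-3/4}` -/
  hKnorm : ∀ t, 0 < t → ‖K t‖ ≤ t ^ (-(3 / 4 : ℝ))
  /-- `K (s+t) = T s ∘ K t` -/
  hKadd : ∀ s t, 0 ≤ s → 0 < t → K (s + t) = (T s).comp (K t)
  /-- `K` commutes with `S` -/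
  hKS : ∀ t, (K t).comp S = S.comp (K t)
  /-- strong continuity of `K` on `(0,∞)` -/
  hKc : ∀ y : Hsp, ContinuousOn (fun t : ℝ => K t y) (Ioi 0)
  /-- the coefficient formula of the bilinear form -/
  hNb : ∀ (y z : Hsp) (i : ι) (k : Fin 3 → ℤ) (a : EuclideanSpace ℝ (Fin 3)) (c : Bool),
    ((b i : Hsp) : Lp (EuclideanSpace ℝ (Fin 3)) 2 (volume : Measure (UnitAddTorus (Fin 3)))) = stokesModeL2 k a c →
    ⟪Nb y z, b i⟫_ℝ = -((m i) ^ (-(3 / 4 : ℝ)) * (1 + m i) ^ (1 / 2 : ℝ)) *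
      ∫ x, ⟪rep (S z) x, convect (rep (S y)) (stokesMode k a c) x⟫_ℝ

namespace ModelFrame

variable (F : ModelFrame)

/-- **Mild solutions of the frame-conjugated equation**: a continuous curve `z` on `[0, t]` solves the mild equation at viscosity `ν` with
frame forcing `xf` from the datum `y` (Henry 1981, (3.3.2)). [cite: Henry1981, §3.3 (3.3.2)] -/
@[folklore] def IsMild (ν : ℝ) (xf : Hsp) {t : ℝ} (ht : 0 ≤ t) (y : Hsp) (z : C(Icc (0 : ℝ) t, Hsp)) : Prop :=
  ∀ r : Icc (0 : ℝ) t, z r = F.T (ν * r) y + (∫ s in (0 : ℝ)..(r : ℝ), F.T (ν * ((r : ℝ) - s)) xf) -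
    ∫ s in (0 : ℝ)..(r : ℝ), F.K (ν * ((r : ℝ) - s)) (F.Nb (z (Set.projIcc 0 t ht s)) (z (Set.projIcc 0 t ht s)))

open Classical in
/-- **The model map** (N-programme §7): for `t ≥ 0`, `g t y` is the value at time `t` of a continuous mild solution on `[0, t]` from `y`
whose range stays in `U'`, when one exists (it is then unique), and the junk `0` otherwise; `g t := g 0` for `t < 0`. [folklore] -/
@[folklore] def modelMap (ν : ℝ) (xf : Hsp) (U' : Set Hsp) (t : ℝ) (y : Hsp) : Hsp :=
  if ht : 0 ≤ t then
    if h : ∃ z : C(Icc (0 : ℝ) t, Hsp), F.IsMild ν xf ht y z ∧ ∀ r, z r ∈ U' then h.choose ⟨t, ht, le_rfl⟩ else 0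
  else (if y ∈ U' then y else 0)

end ModelFrame

end Summit.AnomalousDissipation.AnomalousDissipation.Theorems.DenseLoudDesignerForces.Ergodic

end
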